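import Literature.NumberTheory.GelbartRogawski1991.LocalDoubledUnitaryUnramifiedCell
import Literature.NumberTheory.GelbartRogawski1991.LocalUnitaryUndoubling
import Literature.NumberTheory.Automorphic.UnitaryGroupDoubledSiegelOrbit
import Mathlib.Topology.Algebra.Group.Quotient
import HarnessLib

-- buildfix G11b-3 recipe (LEDGER B13-1/B13-3), as in the GelbartRogawski1991 siblings: elaborate sequentially so the
-- trailing `attribute [implicit_reducible]` block is in force at `.olean` export (inert for the kernel).
set_option Elab.async false

/-!
# The doubled unitary group of an ANISOTROPIC hermitian space at a non-split place:
# `H(F_v) = P_Δ(F_v) · (U(T₀)(F_v) ⊕ 1)` with trivial intersection, and `H(F_v) ⧸ P_Δ(F_v)` is compact when `U(T₀)(F_v)` is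

Topic `NumberTheory/GelbartRogawski1991`; namespace `Literature.NumberTheory.GelbartRogawski1991.UnitaryDualPair.LocalSplitting`
(that of `LocalDoubledUnitaryDatum` ∕ `LocalDoubledUnitarySiegel` ∕ `LocalUnitaryUndoubling`).  KERNEL MATHEMATICS ONLY: theorems,
no definition, no named fact, no `sorry`.

Setting: `E/F` quadratic with conjugation `c`, a finite place `v` of `F`, an `F`-rational symmetric Gram matrix `T₀ ∈ M_n(F)`,
`J = T₀ ⊗ 1`, the doubled datum `J^𝔻 = (T₀ ⊕ −T₀) ⊗ 1` of `LocalDoubledUnitaryDatum` (`gramD`, `hermD`), the doubled group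
`H(F_v) = U(J^𝔻)(F_v) = UnitaryGroup.localPi E c (n + n) JD v`, its Siegel parabolic `P_Δ(F_v) = {h | IsSiegelDelta h}`
(the stabiliser of the Lagrangian `ℓ_Δ = Res Δ`, `Δ = {(u, u)}`), and the doubling embedding
`inlLoc : U(J)(F_v) →* H(F_v)`, `g ↦ g ⊕ 1` of `LocalUnitaryUndoubling`.

This file DOCKS the `K`-points orbit lemma of the tree (★ `UnitaryGroupDoubledSiegelOrbit`:
[GelbartPiatetskishapiroRallis1987, Part A §2 Lemma 2.1 p. 8]: for `𝕍` anisotropic, `P_Δ \ U(𝕍 ⊕ −𝕍) ∕ i(U(𝕍) × 1)` is ONE point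
with trivial stabiliser — every Lagrangian of `𝕍 ⊕ (−𝕍)` meets `𝕍 ⊕ 0` and `0 ⊕ 𝕍` trivially and is the graph of a unique
isometry of `𝕍`) onto the local doubled datum at a place `v` where `E ⊗_F F_v` is a field (`v` non-split) and the hermitian
form `h(x, y) = σ(x)ᵀ (T₀ ⊗ 1) y` on `(E ⊗ F_v)^n` is ANISOTROPIC:

* §1 the dictionary `IsSiegelDelta h ↔ DoubledUnitary.IsSiegelReindex e₂ (matrix of h over E ⊗ F_v)`
  (`isSiegelDelta_iff_isSiegelReindex`), the membership of that matrix in `U(σ, e₂-reindex (T₀ ⊕ −T₀))`, and the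
  STABILISER `IsSiegelDelta (g ⊕ 1) ↔ g = 1` (`isSiegelDelta_inlLoc_iff`, any place);
* §2 **the factorisation** (`v` non-split, `T₀ ⊗ 1` anisotropic over `E ⊗ F_v`): for every `h ∈ H(F_v)` there is a UNIQUE
  `g ∈ U(J)(F_v)` with `h · (g ⊕ 1)⁻¹ ∈ P_Δ(F_v)` (`existsUnique_isSiegelDelta_mul_inlLoc_inv`), and a unique `g` with
  `(g ⊕ 1)⁻¹ · h ∈ P_Δ(F_v)` (`existsUnique_isSiegelDelta_inlLoc_inv_mul`) — `H = P_Δ · (U(J) ⊕ 1) = (U(J) ⊕ 1) · P_Δ`,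
  `P_Δ ∩ (U(J) ⊕ 1) = 1`; the RANK-ONE case (`n = 1`, a hermitian line `W`, `H ≅ U(1,1)`-type) is hypothesis-free
  (`…_of_rank_one`: a non-degenerate line over a field is anisotropic, ★ `DoubledUnitary.anisotropic_of_isUnit_det` with
  ★ `isUnit_det_gramS'`);
* §3 consequences for any bundled copy `P ≤ H(F_v)` of `P_Δ(F_v)` (`∀ h, h ∈ P ↔ IsSiegelDelta h`): `g ↦ (g ⊕ 1) P` is a
  BIJECTION `U(J)(F_v) → H(F_v) ⧸ P` (`bijective_quotientMk_inlLoc`), and **`H(F_v) ⧸ P` is COMPACT as soon as `U(J)(F_v)` is**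
  (`compactSpace_quotient_of_isSiegelDelta`; generic engine `compactSpace_quotient_of_orbit`: a continuous map from a compact
  space meeting every coset) — at a non-split place the rank-one torus `U(W)(F_v) = E_v¹` is compact
  (★ `Liu2021.compactSpace_localPi_one_of_smul_eq`), which is the input `CompactSpace (H ⧸ P_Δ)` of the Weil–Bruhat invariant
  integral (★ `WeilBruhatInvariantIntegral`) on the soft road of the cell's LD line.

The Lagrangian phrasing of (i) «every Lagrangian of `T₀ ⊕ −T₀` is the graph of a unique isometry» is rendered here by its
group-theoretic equivalent §2 (`h⁻¹ ℓ_Δ = graph(g) ⟺ h · (g ⊕ 1)⁻¹ ∈ P_Δ`); the `Submodule` phrasing is not restated because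
`E ⊗ F_v` is a field only propositionally (`IsField (LocalRing E v)`).

Written for the Hodge-CM cell `pub/hodgecm-mathlib`, floor 0, crux `hLiu418`, line LD2 (plate «(S4) Lagrangian factorisation»,
seat LD2-p02, 2026-09-02).  HC_CM is NOT proved here and is proved only modulo the printed citations (2 remaining named inputs
hLiu418, h413) until rung 0 closes.

## References
* [GelbartPiatetskishapiroRallis1987] S. Gelbart, I. Piatetski-Shapiro, S. Rallis, *Explicit Constructions of Automorphic
  L-Functions*, LNM 1254 (1987), Part A §2 Lemma 2.1 p. 8 (orbits of `G × G` on `P\H`; stabiliser of `V^d`).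
* [HarrisKudlaSweet1996] M. Harris, S. S. Kudla, W. J. Sweet, J. Amer. Math. Soc. 9 (1996) 941–1004, §1 (1.9)–(1.11).
* [Kudla1994] S. S. Kudla, Israel J. Math. 87 (1994) 361–401, §3.
* [PlatonovRapinchuk1994] V. Platonov, A. Rapinchuk, *Algebraic Groups and Number Theory* (1994), §3.1 Thm. 3.1.
* [BourbakiGT1] N. Bourbaki, *General Topology, Chapters 1–4*, Chap. III §2 n° 5 Prop. 13, Chap. I §9 n° 4 (quotients, images of compacta).
-/

set_option autoImplicit false

noncomputable section

open NumberField IsDedekindDomain Matrix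
open scoped Topology
open Literature.NumberTheory.Automorphic Literature.NumberTheory.Automorphic.UnitaryGroup

namespace Literature.NumberTheory.GelbartRogawski1991.UnitaryDualPair.LocalSplitting

/-! ## §0 Generic engine: a compact space meeting every coset makes the coset space compact -/

/-- **a continuous map `j : G → H` from a COMPACT space whose image meets every left coset of `P ≤ H` makes `H ⧸ P` compact**
(`H ⧸ P` is the continuous image `γ ↦ (j γ) P` of `G`). [cite: BourbakiGT1, Chap. III §2 n° 5 Prop. 13; Chap. I §9 n° 4 Thm. 2 Cor. 1] -/
theorem compactSpace_quotient_of_orbit {G H : Type*} [Group H] [TopologicalSpace H] [TopologicalSpace G] [CompactSpace G]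
    (P : Subgroup H) {j : G → H} (hj : Continuous j) (horb : ∀ h : H, ∃ γ : G, (j γ)⁻¹ * h ∈ P) :
    CompactSpace (H ⧸ P) := by
  refine ⟨?_⟩
  have hsurj : Set.range (fun γ : G => (QuotientGroup.mk (j γ) : H ⧸ P)) = Set.univ := by
    refine Set.eq_univ_of_forall fun q => ?_
    obtain ⟨h, rfl⟩ := QuotientGroup.mk_surjective q
    obtain ⟨γ, hγ⟩ := horb h
    exact ⟨γ, QuotientGroup.eq.2 hγ⟩
  rw [← hsurj]
  exact isCompact_range (QuotientGroup.continuous_mk.comp hj)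

variable (F : Type) [Field F] [NumberField F] (E : Type) [Field E] [NumberField E] [Algebra F E]
  [Algebra.IsQuadraticExtension F E] (c : E ≃ₐ[F] E)
  {δ : E} (hcδ : c δ = -δ) (hδ : δ ≠ 0) {d : F} (hd : δ * δ = algebraMap F E d)
  (v : HeightOneSpectrum (𝓞 F)) (n : ℕ) {T₀ : Matrix (Fin n) (Fin n) F} (hT₀ : T₀.IsSymm)
  {J : Matrix (Fin n) (Fin n) E} (hJ : J = T₀.map (algebraMap F E))
  {JD : Matrix (Fin (n + n)) (Fin (n + n)) E} (hJD : JD = (gramD F n T₀).map (algebraMap F E))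

/-! ## §1 The dictionary with `UnitaryGroupDoubledSiegelOrbit` and the stabiliser -/

include hcδ hδ hd hT₀ hJD in
/-- **`P_Δ` on the symplectic side = `P_Δ` on the matrix side over `E ⊗ F_v`**: `IsSiegelDelta h` iff the matrix of `h` over
`E ⊗ F_v = Π_{w ∣ v} E_w` satisfies the `e₂`-block condition `h₁₁ + h₁₂ = h₂₁ + h₂₂` (`DoubledUnitary.IsSiegelReindex (e₂ n)`).
[cite: Kudla1994, §3; HarrisKudlaSweet1996, §1 (1.11)] -/
theorem isSiegelDelta_iff_isSiegelReindex (h : UnitaryGroup.localPi E c (n + n) JD v) :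
    IsSiegelDelta F E c hcδ hδ hd v n hT₀ hJD h ↔
      DoubledUnitary.IsSiegelReindex (e₂ n)
        ((localPiEquiv E c (n + n) JD v h : UnitaryGroup.«local» E c (n + n) JD v) : GL (Fin (n + n)) (LocalRing E v)) := by
  rw [isSiegelDelta_iff_blocks, DoubledUnitary.IsSiegelReindex, blocks_eq_iff_forall_place]
  refine forall_congr' fun w => ?_
  rw [coe_component_eq_matS_map]

omit [Algebra.IsQuadraticExtension F E] in
include hJD in
/-- the matrix of `h ∈ H(F_v)` over `E ⊗ F_v` lies in `U(σ, e₂-reindex (T₀ ⊕ −T₀))(E ⊗ F_v)` (`σ = c ⊗ 1`), the group of the orbit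
lemma ★ `DoubledUnitary.existsUnique_isSiegelReindex_mul_inv` (`T₀ ⊕ −T₀ = DoubledUnitary.diagForm (T₀ ⊗ 1)` definitionally). [cite: HarrisKudlaSweet1996, §1 (1.9)] -/
theorem coe_localPiEquiv_mem_unitaryGroupOfForm_reindex_diagForm (h : UnitaryGroup.localPi E c (n + n) JD v) :
    ((localPiEquiv E c (n + n) JD v h : UnitaryGroup.«local» E c (n + n) JD v) : GL (Fin (n + n)) (LocalRing E v)) ∈
      unitaryGroupOfForm (conjLocal E c v)
        (Matrix.reindex (e₂ n) (e₂ n)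
          (Matrix.fromBlocks (gramS F E v n T₀) 0 0 (-(gramS F E v n T₀)))) := by
  have hg := mem_unitaryGroupOfForm_iff.1 (localPiEquiv E c (n + n) JD v h).2
  rw [localFormD_eq F E v n hJD] at hg
  exact mem_unitaryGroupOfForm_iff.2 hg

omit [Algebra.IsQuadraticExtension F E] in
include hJ in
/-- the matrix group of `U(J)(F_v)` is `U(σ, T₀ ⊗ 1)(E ⊗ F_v)` (★ `local_eq`): membership transfer. [cite: HarrisKudlaSweet1996, §1 (1.9)] -/
theorem mem_local_iff_mem_unitaryGroupOfForm_gramS (γ : GL (Fin n) (LocalRing E v)) :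
    γ ∈ UnitaryGroup.«local» E c n J v ↔ γ ∈ unitaryGroupOfForm (conjLocal E c v) (gramS F E v n T₀) := by
  rw [local_eq F E c v n hJ]

include hcδ hδ hd hT₀ hJ hJD in
/-- the dictionary for `h · (g ⊕ 1)⁻¹`: `IsSiegelDelta (h (g ⊕ 1)⁻¹) ↔ IsSiegelReindex e₂ ([h] · (e₂-reindex diag([g], 1))⁻¹)` on the
matrices over `E ⊗ F_v`. [cite: HarrisKudlaSweet1996, §1 (1.11)] -/
theorem isSiegelDelta_mul_inlLoc_inv_iff (h : UnitaryGroup.localPi E c (n + n) JD v) (g : UnitaryGroup.localPi E c n J v) :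
    IsSiegelDelta F E c hcδ hδ hd v n hT₀ hJD (h * (inlLoc F E c v n hJ hJD g)⁻¹) ↔
      DoubledUnitary.IsSiegelReindex (e₂ n)
        (((localPiEquiv E c (n + n) JD v h : UnitaryGroup.«local» E c (n + n) JD v) : GL (Fin (n + n)) (LocalRing E v)) *
          (UnitaryGroup.reindexGL (e₂ n) (UnitaryGroup.blockDiagGL
              (((localPiEquiv E c n J v g : UnitaryGroup.«local» E c n J v) : GL (Fin n) (LocalRing E v)),
                (1 : GL (Fin n) (LocalRing E v)))) : GL (Fin (n + n)) (LocalRing E v))⁻¹) := by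
  have hGL : ((localPiEquiv E c (n + n) JD v (h * (inlLoc F E c v n hJ hJD g)⁻¹) : UnitaryGroup.«local» E c (n + n) JD v) :
        GL (Fin (n + n)) (LocalRing E v)) =
      ((localPiEquiv E c (n + n) JD v h : UnitaryGroup.«local» E c (n + n) JD v) : GL (Fin (n + n)) (LocalRing E v)) *
        (UnitaryGroup.reindexGL (e₂ n) (UnitaryGroup.blockDiagGL
            (((localPiEquiv E c n J v g : UnitaryGroup.«local» E c n J v) : GL (Fin n) (LocalRing E v)),
              (1 : GL (Fin n) (LocalRing E v)))) : GL (Fin (n + n)) (LocalRing E v))⁻¹ := by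
    rw [← coe_inlLocal F E c v n hJ hJD, ← localPiEquiv_inlLoc, map_mul, map_inv]
    rfl
  rw [isSiegelDelta_iff_isSiegelReindex, hGL]

include hcδ hδ hd hT₀ hJ hJD in
/-- the dictionary for `(g ⊕ 1)⁻¹ · h`. [cite: HarrisKudlaSweet1996, §1 (1.11)] -/
theorem isSiegelDelta_inlLoc_inv_mul_iff (h : UnitaryGroup.localPi E c (n + n) JD v) (g : UnitaryGroup.localPi E c n J v) :
    IsSiegelDelta F E c hcδ hδ hd v n hT₀ hJD ((inlLoc F E c v n hJ hJD g)⁻¹ * h) ↔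
      DoubledUnitary.IsSiegelReindex (e₂ n)
        ((UnitaryGroup.reindexGL (e₂ n) (UnitaryGroup.blockDiagGL
              (((localPiEquiv E c n J v g : UnitaryGroup.«local» E c n J v) : GL (Fin n) (LocalRing E v)),
                (1 : GL (Fin n) (LocalRing E v)))) : GL (Fin (n + n)) (LocalRing E v))⁻¹ *
          ((localPiEquiv E c (n + n) JD v h : UnitaryGroup.«local» E c (n + n) JD v) : GL (Fin (n + n)) (LocalRing E v))) := by
  have hGL : ((localPiEquiv E c (n + n) JD v ((inlLoc F E c v n hJ hJD g)⁻¹ * h) : UnitaryGroup.«local» E c (n + n) JD v) :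
        GL (Fin (n + n)) (LocalRing E v)) =
      (UnitaryGroup.reindexGL (e₂ n) (UnitaryGroup.blockDiagGL
            (((localPiEquiv E c n J v g : UnitaryGroup.«local» E c n J v) : GL (Fin n) (LocalRing E v)),
              (1 : GL (Fin n) (LocalRing E v)))) : GL (Fin (n + n)) (LocalRing E v))⁻¹ *
        ((localPiEquiv E c (n + n) JD v h : UnitaryGroup.«local» E c (n + n) JD v) : GL (Fin (n + n)) (LocalRing E v)) := by
    rw [← coe_inlLocal F E c v n hJ hJD, ← localPiEquiv_inlLoc, map_mul, map_inv]
    rfl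
  rw [isSiegelDelta_iff_isSiegelReindex, hGL]

include hcδ hδ hd hT₀ hJ hJD in
/-- **the stabiliser: `P_Δ(F_v) ∩ (U(J)(F_v) ⊕ 1) = 1`** — `g ⊕ 1 ∈ P_Δ(F_v) ↔ g = 1` (the `e₂`-blocks of `g ⊕ 1` are `g, 0, 0, 1`;
any place `v`). [cite: GelbartPiatetskishapiroRallis1987, Part A §2 p. 9] -/
theorem isSiegelDelta_inlLoc_iff (g : UnitaryGroup.localPi E c n J v) :
    IsSiegelDelta F E c hcδ hδ hd v n hT₀ hJD (inlLoc F E c v n hJ hJD g) ↔ g = 1 := by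
  rw [isSiegelDelta_iff_isSiegelReindex, localPiEquiv_inlLoc, coe_inlLocal, DoubledUnitary.IsSiegelReindex,
    UnitaryGroup.coe_reindexGL, UnitaryGroup.coe_blockDiagGL]
  simp only [Matrix.reindex_apply, Matrix.submatrix_submatrix, Equiv.symm_symm, Equiv.symm_comp_self, Matrix.submatrix_id_id,
    Matrix.toBlocks_fromBlocks₁₁, Matrix.toBlocks_fromBlocks₁₂, Matrix.toBlocks_fromBlocks₂₁, Matrix.toBlocks_fromBlocks₂₂,
    add_zero, zero_add, Units.val_one, Units.val_eq_one, OneMemClass.coe_eq_one, EmbeddingLike.map_eq_one_iff]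

/-! ## §2 The factorisation `H(F_v) = P_Δ(F_v) · (U(J)(F_v) ⊕ 1)` at a non-split place for `T₀ ⊗ 1` anisotropic -/

include hcδ hδ hd hT₀ hJ hJD in
/-- **THE FACTORISATION `H(F_v) = P_Δ(F_v) · (U(J)(F_v) ⊕ 1)`, with uniqueness**: at a place `v` where `E ⊗ F_v` is a field and
for `T₀ ⊗ 1` ANISOTROPIC over `E ⊗ F_v`, every `h ∈ H(F_v) = U(T₀ ⊕ −T₀)(F_v)` has a UNIQUE `g ∈ U(J)(F_v)` with
`h · (g ⊕ 1)⁻¹ ∈ P_Δ(F_v)` — equivalently `h⁻¹ ℓ_Δ` is the graph of `g`; `g ↦ P_Δ (g ⊕ 1)` is a bijection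
`U(J)(F_v) ≃ P_Δ(F_v) \ H(F_v)`. [cite: GelbartPiatetskishapiroRallis1987, Part A §2 Lemma 2.1 p. 8; HarrisKudlaSweet1996, §1 (1.11)] -/
theorem existsUnique_isSiegelDelta_mul_inlLoc_inv (hE : IsField (LocalRing E v))
    (hS : ∀ x : Fin n → LocalRing E v, hermForm (conjLocal E c v) (gramS F E v n T₀) x x = 0 → x = 0)
    (h : UnitaryGroup.localPi E c (n + n) JD v) :
    ∃! g : UnitaryGroup.localPi E c n J v, IsSiegelDelta F E c hcδ hδ hd v n hT₀ hJD (h * (inlLoc F E c v n hJ hJD g)⁻¹) := by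
  classical
  letI : Field (LocalRing E v) := hE.toField
  obtain ⟨γ, ⟨hγ, hγS⟩, huniq⟩ := DoubledUnitary.existsUnique_isSiegelReindex_mul_inv (e₂ n) hS
    (coe_localPiEquiv_mem_unitaryGroupOfForm_reindex_diagForm F E c v n hJD h)
  have hγ' : γ ∈ UnitaryGroup.«local» E c n J v := (mem_local_iff_mem_unitaryGroupOfForm_gramS F E c v n hJ γ).2 hγ
  refine ⟨(localPiEquiv E c n J v).symm ⟨γ, hγ'⟩, ?_, fun g' hg' => ?_⟩
  · dsimp only
    rw [isSiegelDelta_mul_inlLoc_inv_iff, (localPiEquiv E c n J v).apply_symm_apply]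
    exact hγS
  · dsimp only at hg'
    rw [isSiegelDelta_mul_inlLoc_inv_iff] at hg'
    have hmem : ((localPiEquiv E c n J v g' : UnitaryGroup.«local» E c n J v) : GL (Fin n) (LocalRing E v)) ∈
        unitaryGroupOfForm (conjLocal E c v) (gramS F E v n T₀) :=
      (mem_local_iff_mem_unitaryGroupOfForm_gramS F E c v n hJ _).1 (localPiEquiv E c n J v g').2
    have heq := huniq _ ⟨hmem, hg'⟩
    rw [(localPiEquiv E c n J v).eq_symm_apply]
    exact Subtype.ext heq

include hcδ hδ hd hT₀ hJ hJD in
/-- **mirror form `H(F_v) = (U(J)(F_v) ⊕ 1) · P_Δ(F_v)`**: a UNIQUE `g ∈ U(J)(F_v)` with `(g ⊕ 1)⁻¹ · h ∈ P_Δ(F_v)` — `h ℓ_Δ` is the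
graph of `g⁻¹`; `g ↦ (g ⊕ 1) P_Δ` is a bijection `U(J)(F_v) ≃ H(F_v) ⧸ P_Δ(F_v)`.
[cite: GelbartPiatetskishapiroRallis1987, Part A §2 Lemma 2.1 p. 8; HarrisKudlaSweet1996, §1 (1.11)] -/
theorem existsUnique_isSiegelDelta_inlLoc_inv_mul (hE : IsField (LocalRing E v))
    (hS : ∀ x : Fin n → LocalRing E v, hermForm (conjLocal E c v) (gramS F E v n T₀) x x = 0 → x = 0)
    (h : UnitaryGroup.localPi E c (n + n) JD v) :
    ∃! g : UnitaryGroup.localPi E c n J v, IsSiegelDelta F E c hcδ hδ hd v n hT₀ hJD ((inlLoc F E c v n hJ hJD g)⁻¹ * h) := by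
  classical
  letI : Field (LocalRing E v) := hE.toField
  obtain ⟨γ, ⟨hγ, hγS⟩, huniq⟩ := DoubledUnitary.existsUnique_isSiegelReindex_inv_mul (e₂ n) hS
    (coe_localPiEquiv_mem_unitaryGroupOfForm_reindex_diagForm F E c v n hJD h)
  have hγ' : γ ∈ UnitaryGroup.«local» E c n J v := (mem_local_iff_mem_unitaryGroupOfForm_gramS F E c v n hJ γ).2 hγ
  refine ⟨(localPiEquiv E c n J v).symm ⟨γ, hγ'⟩, ?_, fun g' hg' => ?_⟩
  · dsimp only
    rw [isSiegelDelta_inlLoc_inv_mul_iff, (localPiEquiv E c n J v).apply_symm_apply]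
    exact hγS
  · dsimp only at hg'
    rw [isSiegelDelta_inlLoc_inv_mul_iff] at hg'
    have hmem : ((localPiEquiv E c n J v g' : UnitaryGroup.«local» E c n J v) : GL (Fin n) (LocalRing E v)) ∈
        unitaryGroupOfForm (conjLocal E c v) (gramS F E v n T₀) :=
      (mem_local_iff_mem_unitaryGroupOfForm_gramS F E c v n hJ _).1 (localPiEquiv E c n J v g').2
    have heq := huniq _ ⟨hmem, hg'⟩
    rw [(localPiEquiv E c n J v).eq_symm_apply]
    exact Subtype.ext heq

include hcδ hδ hd hT₀ hJ hJD in
/-- the factorisation spelled out: `h = p · (g ⊕ 1)` with `p ∈ P_Δ(F_v)`, `g ∈ U(J)(F_v)`.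
[cite: GelbartPiatetskishapiroRallis1987, Part A §2 Lemma 2.1 p. 8] -/
theorem exists_isSiegelDelta_mul_inlLoc_eq (hE : IsField (LocalRing E v))
    (hS : ∀ x : Fin n → LocalRing E v, hermForm (conjLocal E c v) (gramS F E v n T₀) x x = 0 → x = 0)
    (h : UnitaryGroup.localPi E c (n + n) JD v) :
    ∃ (p : UnitaryGroup.localPi E c (n + n) JD v) (g : UnitaryGroup.localPi E c n J v),
      IsSiegelDelta F E c hcδ hδ hd v n hT₀ hJD p ∧ h = p * inlLoc F E c v n hJ hJD g := by
  obtain ⟨g, hg, -⟩ := existsUnique_isSiegelDelta_mul_inlLoc_inv F E c hcδ hδ hd v n hT₀ hJ hJD hE hS h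
  exact ⟨h * (inlLoc F E c v n hJ hJD g)⁻¹, g, hg, (inv_mul_cancel_right h _).symm⟩

include hcδ hδ hd hT₀ hJ hJD in
/-- two factorisations `p · (g ⊕ 1) = p′ · (g′ ⊕ 1)` have `g = g′` (and then `p = p′`). [cite: GelbartPiatetskishapiroRallis1987, Part A §2 Lemma 2.1 p. 8] -/
theorem inlLoc_unique_of_isSiegelDelta (hE : IsField (LocalRing E v))
    (hS : ∀ x : Fin n → LocalRing E v, hermForm (conjLocal E c v) (gramS F E v n T₀) x x = 0 → x = 0)
    {p p' : UnitaryGroup.localPi E c (n + n) JD v} {g g' : UnitaryGroup.localPi E c n J v}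
    (hp : IsSiegelDelta F E c hcδ hδ hd v n hT₀ hJD p) (hp' : IsSiegelDelta F E c hcδ hδ hd v n hT₀ hJD p')
    (heq : p * inlLoc F E c v n hJ hJD g = p' * inlLoc F E c v n hJ hJD g') : g = g' ∧ p = p' := by
  have h1 : IsSiegelDelta F E c hcδ hδ hd v n hT₀ hJD (p * inlLoc F E c v n hJ hJD g * (inlLoc F E c v n hJ hJD g)⁻¹) := by
    rw [mul_inv_cancel_right]; exact hp
  have h2 : IsSiegelDelta F E c hcδ hδ hd v n hT₀ hJD (p * inlLoc F E c v n hJ hJD g * (inlLoc F E c v n hJ hJD g')⁻¹) := by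
    rw [heq, mul_inv_cancel_right]; exact hp'
  have hgg : g = g' :=
    (existsUnique_isSiegelDelta_mul_inlLoc_inv F E c hcδ hδ hd v n hT₀ hJ hJD hE hS (p * inlLoc F E c v n hJ hJD g)).unique h1 h2
  refine ⟨hgg, ?_⟩
  rw [hgg] at heq
  exact mul_right_cancel heq

/-! ### Rank one: a non-degenerate hermitian line over a field is anisotropic -/

omit [Algebra.IsQuadraticExtension F E] in
/-- **in rank one the line `T₁ ⊗ 1` is anisotropic over the field `E ⊗ F_v`** (`v` non-split). [cite: Li1992, §2 p. 182] -/
theorem anisotropic_gramS_of_rank_one (hE : IsField (LocalRing E v)) {T₁ : Matrix (Fin 1) (Fin 1) F} (hT₁d : IsUnit T₁.det)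
    (x : Fin 1 → LocalRing E v) (hx : hermForm (conjLocal E c v) (gramS F E v 1 T₁) x x = 0) : x = 0 := by
  letI : Field (LocalRing E v) := hE.toField
  exact DoubledUnitary.anisotropic_of_isUnit_det (conjLocal E c v) (isUnit_det_gramS' F E v 1 hT₁d) x hx

include hcδ hδ hd in
/-- **RANK ONE** (`W` a hermitian line, `H = U(W ⊕ −W)(F_v)`, `v` non-split): every `h ∈ H(F_v)` has a UNIQUE `g ∈ U(W)(F_v) = E_v¹`
with `h · (g ⊕ 1)⁻¹ ∈ P_Δ(F_v)` — no anisotropy hypothesis. [cite: GelbartPiatetskishapiroRallis1987, Part A §2 Lemma 2.1 p. 8; Li1992, §2 (24)–(25) p. 184] -/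
theorem existsUnique_isSiegelDelta_mul_inlLoc_inv_of_rank_one (hE : IsField (LocalRing E v))
    {T₁ : Matrix (Fin 1) (Fin 1) F} (hT₁ : T₁.IsSymm) (hT₁d : IsUnit T₁.det)
    {J₁ : Matrix (Fin 1) (Fin 1) E} (hJ₁ : J₁ = T₁.map (algebraMap F E))
    {JD₁ : Matrix (Fin (1 + 1)) (Fin (1 + 1)) E} (hJD₁ : JD₁ = (gramD F 1 T₁).map (algebraMap F E))
    (h : UnitaryGroup.localPi E c (1 + 1) JD₁ v) :
    ∃! g : UnitaryGroup.localPi E c 1 J₁ v, IsSiegelDelta F E c hcδ hδ hd v 1 hT₁ hJD₁ (h * (inlLoc F E c v 1 hJ₁ hJD₁ g)⁻¹) :=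
  existsUnique_isSiegelDelta_mul_inlLoc_inv F E c hcδ hδ hd v 1 hT₁ hJ₁ hJD₁ hE
    (anisotropic_gramS_of_rank_one F E c v hE hT₁d) h

include hcδ hδ hd in
/-- **RANK ONE, mirror form**: a UNIQUE `g ∈ U(W)(F_v)` with `(g ⊕ 1)⁻¹ · h ∈ P_Δ(F_v)`.
[cite: GelbartPiatetskishapiroRallis1987, Part A §2 Lemma 2.1 p. 8; Li1992, §2 (24)–(25) p. 184] -/
theorem existsUnique_isSiegelDelta_inlLoc_inv_mul_of_rank_one (hE : IsField (LocalRing E v))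
    {T₁ : Matrix (Fin 1) (Fin 1) F} (hT₁ : T₁.IsSymm) (hT₁d : IsUnit T₁.det)
    {J₁ : Matrix (Fin 1) (Fin 1) E} (hJ₁ : J₁ = T₁.map (algebraMap F E))
    {JD₁ : Matrix (Fin (1 + 1)) (Fin (1 + 1)) E} (hJD₁ : JD₁ = (gramD F 1 T₁).map (algebraMap F E))
    (h : UnitaryGroup.localPi E c (1 + 1) JD₁ v) :
    ∃! g : UnitaryGroup.localPi E c 1 J₁ v, IsSiegelDelta F E c hcδ hδ hd v 1 hT₁ hJD₁ ((inlLoc F E c v 1 hJ₁ hJD₁ g)⁻¹ * h) :=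
  existsUnique_isSiegelDelta_inlLoc_inv_mul F E c hcδ hδ hd v 1 hT₁ hJ₁ hJD₁ hE
    (anisotropic_gramS_of_rank_one F E c v hE hT₁d) h

/-! ## §3 Bundled copies of `P_Δ(F_v)`: the bijection `U(J)(F_v) ≃ H(F_v) ⧸ P_Δ` and compactness of `H(F_v) ⧸ P_Δ` -/

include hcδ hδ hd hT₀ hJ hJD in
/-- **`g ↦ (g ⊕ 1) P_Δ` is a BIJECTION `U(J)(F_v) → H(F_v) ⧸ P`** for any subgroup `P ≤ H(F_v)` whose membership is `IsSiegelDelta`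
(one orbit + trivial stabiliser, ★ `DoubledUnitary.bijective_quotientMk_of_orbit`). [cite: GelbartPiatetskishapiroRallis1987, Part A §2 Lemma 2.1 p. 8] -/
theorem bijective_quotientMk_inlLoc (hE : IsField (LocalRing E v))
    (hS : ∀ x : Fin n → LocalRing E v, hermForm (conjLocal E c v) (gramS F E v n T₀) x x = 0 → x = 0)
    (P : Subgroup (UnitaryGroup.localPi E c (n + n) JD v)) (hP : ∀ h, h ∈ P ↔ IsSiegelDelta F E c hcδ hδ hd v n hT₀ hJD h) :
    Function.Bijective (fun g : UnitaryGroup.localPi E c n J v =>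
      (QuotientGroup.mk (inlLoc F E c v n hJ hJD g) : UnitaryGroup.localPi E c (n + n) JD v ⧸ P)) :=
  DoubledUnitary.bijective_quotientMk_of_orbit P (inlLoc F E c v n hJ hJD)
    (fun h => by
      obtain ⟨g, hg, -⟩ := existsUnique_isSiegelDelta_inlLoc_inv_mul F E c hcδ hδ hd v n hT₀ hJ hJD hE hS h
      exact ⟨g, (hP _).2 hg⟩)
    (fun g hg => (isSiegelDelta_inlLoc_iff F E c hcδ hδ hd v n hT₀ hJ hJD g).1 ((hP _).1 hg))

include hcδ hδ hd hT₀ hJ hJD in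
/-- **`g ↦ P_Δ (g ⊕ 1)` is a BIJECTION `U(J)(F_v) → P \ H(F_v)`** (right cosets; the index set of a Siegel Eisenstein sum).
[cite: GelbartPiatetskishapiroRallis1987, Part A §2 Lemma 2.1 p. 8] -/
theorem bijective_rightCosetMk_inlLoc (hE : IsField (LocalRing E v))
    (hS : ∀ x : Fin n → LocalRing E v, hermForm (conjLocal E c v) (gramS F E v n T₀) x x = 0 → x = 0)
    (P : Subgroup (UnitaryGroup.localPi E c (n + n) JD v)) (hP : ∀ h, h ∈ P ↔ IsSiegelDelta F E c hcδ hδ hd v n hT₀ hJD h) :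
    Function.Bijective (fun g : UnitaryGroup.localPi E c n J v =>
      Quotient.mk (QuotientGroup.rightRel P) (inlLoc F E c v n hJ hJD g)) :=
  DoubledUnitary.bijective_rightCosetMk_of_orbit P (inlLoc F E c v n hJ hJD)
    (fun h => by
      obtain ⟨g, hg, -⟩ := existsUnique_isSiegelDelta_mul_inlLoc_inv F E c hcδ hδ hd v n hT₀ hJ hJD hE hS h
      exact ⟨g, (hP _).2 hg⟩)
    (fun g hg => (isSiegelDelta_inlLoc_iff F E c hcδ hδ hd v n hT₀ hJ hJD g).1 ((hP _).1 hg))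

include hcδ hδ hd hT₀ hJ hJD in
/-- **`H(F_v) ⧸ P_Δ(F_v)` is COMPACT whenever `U(J)(F_v)` is** (`v` non-split, `T₀ ⊗ 1` anisotropic; `P` any bundled copy of
`P_Δ(F_v)`): `H ⧸ P` is the continuous image of the compact `U(J)(F_v)` under `g ↦ (g ⊕ 1) P`.  For an anisotropic `T₀` the group
`U(J)(F_v)` IS compact ([PlatonovRapinchuk1994, §3.1 Thm. 3.1]; in the tree for the rank-one torus at a non-split place,
★ `Liu2021.compactSpace_localPi_one_of_smul_eq`), whence the instance hypothesis.
[cite: GelbartPiatetskishapiroRallis1987, Part A §2 Lemma 2.1 p. 8; PlatonovRapinchuk1994, §3.1 Thm. 3.1] -/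
theorem compactSpace_quotient_of_isSiegelDelta (hE : IsField (LocalRing E v))
    (hS : ∀ x : Fin n → LocalRing E v, hermForm (conjLocal E c v) (gramS F E v n T₀) x x = 0 → x = 0)
    [CompactSpace (UnitaryGroup.localPi E c n J v)]
    (P : Subgroup (UnitaryGroup.localPi E c (n + n) JD v)) (hP : ∀ h, h ∈ P ↔ IsSiegelDelta F E c hcδ hδ hd v n hT₀ hJD h) :
    CompactSpace (UnitaryGroup.localPi E c (n + n) JD v ⧸ P) :=
  compactSpace_quotient_of_orbit P (continuous_inlLoc F E c v n hJ hJD) fun h => by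
    obtain ⟨g, hg, -⟩ := existsUnique_isSiegelDelta_inlLoc_inv_mul F E c hcδ hδ hd v n hT₀ hJ hJD hE hS h
    exact ⟨g, (hP _).2 hg⟩

include hcδ hδ hd hT₀ hJ hJD in
/-- right-coset twin: `P \ H(F_v)` (`Quotient (QuotientGroup.rightRel P)`) is compact whenever `U(J)(F_v)` is.
[cite: GelbartPiatetskishapiroRallis1987, Part A §2 Lemma 2.1 p. 8; PlatonovRapinchuk1994, §3.1 Thm. 3.1] -/
theorem compactSpace_rightCoset_of_isSiegelDelta (hE : IsField (LocalRing E v))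
    (hS : ∀ x : Fin n → LocalRing E v, hermForm (conjLocal E c v) (gramS F E v n T₀) x x = 0 → x = 0)
    [CompactSpace (UnitaryGroup.localPi E c n J v)]
    (P : Subgroup (UnitaryGroup.localPi E c (n + n) JD v)) (hP : ∀ h, h ∈ P ↔ IsSiegelDelta F E c hcδ hδ hd v n hT₀ hJD h) :
    CompactSpace (Quotient (QuotientGroup.rightRel P)) := by
  refine ⟨?_⟩
  have hsurj : Set.range (fun g : UnitaryGroup.localPi E c n J v =>
      Quotient.mk (QuotientGroup.rightRel P) (inlLoc F E c v n hJ hJD g)) = Set.univ :=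
    Set.eq_univ_of_forall fun q => (bijective_rightCosetMk_inlLoc F E c hcδ hδ hd v n hT₀ hJ hJD hE hS P hP).2 q
  rw [← hsurj]
  exact isCompact_range (continuous_quot_mk.comp (continuous_inlLoc F E c v n hJ hJD))

end Literature.NumberTheory.GelbartRogawski1991.UnitaryDualPair.LocalSplitting

end
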